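import Mathlib
import Literature.NumberTheory.Automorphic.MatrixTwoConjugacy
import HarnessLib

set_option autoImplicit false

-- the summit and its single problem are both named `BirchSwinnertonDyer` (registry layout D-0017)
set_option linter.dupNamespace false

/-!
# `2 × 2` matrix kernels: Cayley–Hamilton, the Lucas trace expansion, unipotence from self-conjugacy
# (helpers for crux stmt-BirchSwinnertonDyer-20547 `KatoDivisibilityX9`, line `prime_adapted_tau`, stub 3 (U))

Definition-free, Mathlib-only lemmas about `Matrix (Fin 2) (Fin 2) R` over a commutative ring `R` (a domain
where stated), ported verbatim from the bsd-f3-mu cell's kernel-checked sketch `Sketch71.lean` v5 f376123484d02b28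
(planner-bsd-f3-mu-desc g71, §A; port plan PORT-PLAN-72 file P1, desc g72).  They are the ring-theoretic kernels of the
local monodromy analysis of a Hida datum at a multiplicative prime (`…ULedgerSpecialisationKernels.lean`,
`…ULedgerTateMonodromyDigits.lean`):

* (Cayley–Hamilton `u² = tr u · u − det u · 1` is the tree's `Literature.NumberTheory.Automorphic.matrixTwo_mul_self`;
  the sketch's copy `mul_self_eq_fin_two` is not re-landed); `mul_add_mul_eq_fin_two` — its polarisation;
  `det_one_add_fin_two` — `det (1 + ν) = 1 + tr ν + det ν` over any commutative ring (the tree's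
  `Literature.GroupTheory.SpecificGroups.PGL2.det_one_add_fin_two` is the field case);
* `trace_pow_succ_succ`, `trace_pow_expansion` — the trace recursion and the LUCAS EXPANSION
  `tr uⁿ = 2 + n² (tr u − 2) + (tr u − 2)² rₙ` for `det u = 1`;
* `eq_one_of_pow_eq_one`, `unipotent_of_conj_pow` — STEP 2 of the sketch: over a domain with a prime `P`, a matrix
  conjugate to its own `v`-th power with `det ≡ 1`, `tr ≡ 2 (mod P)` and `v − 1, v² − 1 ∉ P` satisfies `(u − 1)² = 0`;
* `trace_det_eq_zero_of_sq_zero` — a square-zero matrix over a domain has trace and determinant `0`.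

Folklore linear algebra; no ledger item is closed here.  The `nilMat` / `outerNil` kernels (unimodular cokernels,
normal form of a square-zero matrix) are in `…ULedgerNilpotentNormalForm.lean`.
-/

open scoped Classical
open Matrix Finset
open Literature.NumberTheory.Automorphic (matrixTwo_mul_self)

noncomputable section

namespace Summit.BirchSwinnertonDyer.BirchSwinnertonDyer.Theorems.OneSidedTwistSqueezeX9KatoDivisibilityX9ULedger

section Kernels

variable {R : Type*} [CommRing R]

/-- The trace recursion `tr u^{n+2} = tr u · tr u^{n+1} − det u · tr uⁿ`. [folklore] -/
theorem trace_pow_succ_succ (u : Matrix (Fin 2) (Fin 2) R) (n : ℕ) :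
    (u ^ (n + 2)).trace = u.trace * (u ^ (n + 1)).trace - u.det * (u ^ n).trace := by
  have h : u ^ (n + 2) = u ^ n * (u * u) := by rw [pow_add, pow_two]
  rw [h, matrixTwo_mul_self, mul_sub, Matrix.mul_smul, Matrix.mul_smul, mul_one, Matrix.trace_sub,
    Matrix.trace_smul, Matrix.trace_smul, smul_eq_mul, smul_eq_mul, ← pow_succ]

/-- LUCAS EXPANSION: for `det u = 1`, `tr uⁿ = 2 + n² (tr u − 2) + (tr u − 2)² · rₙ`. [folklore] -/
theorem trace_pow_expansion (u : Matrix (Fin 2) (Fin 2) R) (hdet : u.det = 1) (n : ℕ) :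
    ∃ r : R, (u ^ n).trace = 2 + (n : R) ^ 2 * (u.trace - 2) + (u.trace - 2) ^ 2 * r := by
  induction n using Nat.twoStepInduction with
  | zero =>
    refine ⟨0, ?_⟩
    rw [pow_zero, Matrix.trace_one, Fintype.card_fin]
    push_cast
    ring
  | one => exact ⟨0, by rw [pow_one]; push_cast; ring⟩
  | more n h0 h1 =>
    obtain ⟨r0, h0⟩ := h0
    obtain ⟨r1, h1⟩ := h1
    refine ⟨(2 + (u.trace - 2)) * r1 - r0 + ((n : R) + 1) ^ 2, ?_⟩
    rw [trace_pow_succ_succ, hdet, one_mul, h1, h0]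
    push_cast
    ring

/-- In a domain, modulo an ideal `P`: if `d − 1 ∈ P` and `d ^ k = 1` with `(k : R) ∉ P`, then `d = 1`
(geometric sum: `(∑_{i<k} dⁱ)(d − 1) = 0` and `∑_{i<k} dⁱ ≡ k`). [folklore] -/
theorem eq_one_of_pow_eq_one [IsDomain R] (P : Ideal R) (d : R) (hd : d - 1 ∈ P)
    (k : ℕ) (hk : (k : R) ∉ P) (hdk : d ^ k = 1) : d = 1 := by
  have hgeom : (∑ i ∈ range k, d ^ i) * (d - 1) = 0 := by rw [geom_sum_mul, hdk, sub_self]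
  rcases mul_eq_zero.mp hgeom with hsum | hsub
  · exfalso
    apply hk
    -- `∑_{i<k} dⁱ − k = ∑_{i<k} (dⁱ − 1) ∈ P`
    have hmem : ∀ i : ℕ, d ^ i - 1 ∈ P := by
      intro i
      have : d ^ i - 1 = (∑ j ∈ range i, d ^ j) * (d - 1) := (geom_sum_mul d i).symm
      rw [this]
      exact P.mul_mem_left _ hd
    have hdiff : (∑ i ∈ range k, d ^ i) - (k : R) = ∑ i ∈ range k, (d ^ i - 1) := by
      rw [Finset.sum_sub_distrib, Finset.sum_const, Finset.card_range, nsmul_eq_mul, mul_one]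
    have hin : (∑ i ∈ range k, d ^ i) - (k : R) ∈ P := by
      rw [hdiff]; exact P.sum_mem fun i _ => hmem i
    rw [hsum, zero_sub] at hin
    simpa using P.neg_mem hin
  · exact sub_eq_zero.mp hsub

/-- **STEP 2 (unipotence from the datum alone).**  Over a domain `R` with a proper prime `P`: a `2 × 2` matrix `u`
conjugate to its own `v`-th power (`F u F' = u ^ v`, `F' F = 1`), with `det u ≡ 1`, `tr u ≡ 2 (mod P)` and
`v − 1, v² − 1 ∉ P`, satisfies `(u − 1)² = 0`. [folklore] -/
theorem unipotent_of_conj_pow [IsDomain R] (P : Ideal R) [P.IsPrime] (u F F' : Matrix (Fin 2) (Fin 2) R)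
    (hF : F' * F = 1) (v : ℕ) (hconj : F * u * F' = u ^ v) (hv1 : ((v : R) - 1) ∉ P)
    (hv2 : ((v : R) ^ 2 - 1) ∉ P) (hdet : u.det - 1 ∈ P) (htr : u.trace - 2 ∈ P) :
    (u - 1) * (u - 1) = 0 := by
  have hPtop : P ≠ ⊤ := Ideal.IsPrime.ne_top ‹_›
  -- determinant: `det u ^ v = det u`
  have hdd : u.det ^ v = u.det := by
    have h1 : (F * u * F').det = u.det := by
      have hFF' : F * F' = 1 := mul_eq_one_comm.mp hF
      have hdd' : F.det * F'.det = 1 := by rw [← Matrix.det_mul, hFF', Matrix.det_one]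
      rw [Matrix.det_mul, Matrix.det_mul]
      calc F.det * u.det * F'.det = u.det * (F.det * F'.det) := by ring
        _ = u.det := by rw [hdd', mul_one]
    rw [← Matrix.det_pow, ← hconj, h1]
  -- hence `det u = 1`
  have hd1 : u.det = 1 := by
    rcases Nat.eq_zero_or_pos v with hv0 | hvpos
    · subst hv0; simpa using hdd.symm
    · obtain ⟨k, rfl⟩ : ∃ k, v = k + 1 := ⟨v - 1, by omega⟩
      have hfac : u.det * (u.det ^ k - 1) = 0 := by
        rw [mul_sub, mul_one, ← pow_succ', hdd, sub_self]
      rcases mul_eq_zero.mp hfac with h0 | hk1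
      · exfalso
        rw [h0, zero_sub] at hdet
        exact hPtop ((Ideal.eq_top_iff_one P).mpr (by simpa using P.neg_mem hdet))
      · have hkP : (k : R) ∉ P := by
          intro hkin
          apply hv1
          push_cast
          simpa using hkin
        exact eq_one_of_pow_eq_one P u.det hdet k hkP (sub_eq_zero.mp hk1)
  -- trace: `tr u ^ v = tr u`
  have htt : (u ^ v).trace = u.trace := by
    rw [← hconj, Matrix.trace_mul_cycle, hF, one_mul]
  obtain ⟨r, hr⟩ := trace_pow_expansion u hd1 v
  set x : R := u.trace - 2 with hx
  have hkey : x * (((v : R) ^ 2 - 1) + x * r) = 0 := by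
    have : (u ^ v).trace - u.trace = 0 := sub_eq_zero.mpr htt
    rw [hr] at this
    linear_combination this
  have hx0 : x = 0 := by
    rcases mul_eq_zero.mp hkey with h | h
    · exact h
    · exfalso
      apply hv2
      have : ((v : R) ^ 2 - 1) = -(x * r) := by linear_combination h
      rw [this]
      exact P.neg_mem (P.mul_mem_right _ htr)
  have ht2 : u.trace = 2 := by rw [hx] at hx0; exact (sub_eq_zero.mp hx0)
  have hCH : u * u = (2 : R) • u - (1 : R) • (1 : Matrix (Fin 2) (Fin 2) R) := by
    rw [matrixTwo_mul_self, ht2, hd1]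
  calc (u - 1) * (u - 1) = u * u - u - u + 1 := by noncomm_ring
    _ = 0 := by rw [hCH, two_smul, one_smul]; abel

/-- Polarised Cayley–Hamilton for `2 × 2` matrices. [folklore] -/
theorem mul_add_mul_eq_fin_two (A B : Matrix (Fin 2) (Fin 2) R) :
    A * B + B * A = A.trace • B + B.trace • A + ((A * B).trace - A.trace * B.trace) • (1 : Matrix (Fin 2) (Fin 2) R) := by
  ext i j
  fin_cases i <;> fin_cases j <;>
    simp [Matrix.mul_apply, Fin.sum_univ_two, Matrix.trace_fin_two] <;> ring

/-- A square-zero `2 × 2` matrix over a domain has trace `0` and determinant `0`. [folklore] -/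
theorem trace_det_eq_zero_of_sq_zero [IsDomain R] (ν : Matrix (Fin 2) (Fin 2) R) (hν : ν * ν = 0) :
    ν.trace = 0 ∧ ν.det = 0 := by
  have hdet : ν.det = 0 := by
    have : ν.det * ν.det = 0 := by rw [← Matrix.det_mul, hν, Matrix.det_zero]
    exact mul_self_eq_zero.mp this
  refine ⟨?_, hdet⟩
  have hCH := matrixTwo_mul_self ν
  rw [hν, hdet, zero_smul, sub_zero] at hCH
  have htr : ν.trace * ν.trace = 0 := by
    have := congrArg Matrix.trace hCH
    rw [Matrix.trace_zero, Matrix.trace_smul, smul_eq_mul] at this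
    exact this.symm
  exact mul_self_eq_zero.mp htr

/-- `det (1 + ν) = 1 + tr ν + det ν` for `2 × 2` matrices over a commutative ring (generalises the field case
`Literature.GroupTheory.SpecificGroups.PGL2.det_one_add_fin_two`). [folklore] -/
theorem det_one_add_fin_two (ν : Matrix (Fin 2) (Fin 2) R) :
    (1 + ν).det = 1 + ν.trace + ν.det := by
  simp [Matrix.det_fin_two, Matrix.trace_fin_two, Matrix.add_apply]
  ring

end Kernels

end Summit.BirchSwinnertonDyer.BirchSwinnertonDyer.Theorems.OneSidedTwistSqueezeX9KatoDivisibilityX9ULedger
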